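import Literature.AlgebraicGeometry.AbelianSchemes.RigidifyAlongUnitSlice
import Literature.AlgebraicGeometry.AbelianSchemes.AbelianSchemeBaseChangeComp
import Literature.AlgebraicGeometry.AbelianVarieties.PoincareSheafOfPrincipal
import Literature.AlgebraicGeometry.AbelianVarieties.TheoremOfTheSquareCechPic
import Literature.AlgebraicGeometry.Modules.DetClassTensorDualPullback
import Literature.AlgebraicGeometry.Modules.UnitCocyclePresented
import Literature.AlgebraicGeometry.Modules.ExtensionContraction
import HarnessLib

/-!
# Rigidifications kill the twist over a base: the seesaw sheaf comes from the base iff the graph condition holds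
# (F-3 (Mc) node N2a′ — the RELATIVE port of ★ `Motives/PoincareUniversal/SeesawSheafIffGraphCond`)

Layer `Literature/AlgebraicGeometry/AbelianSchemes`, namespace `Literature.AlgebraicGeometry.AbelianSchemes.AbelianSchemeOver`.  THEOREMS
ONLY (no definition, no named fact, no instance, no notation, no `sorry`).  Cell `hodgecm-mathlib` (D-0151 / D-0183 FLOOR 0), programme P1,
sub-line F-3 «dual abelian scheme», child letter (M), grandchild node table (Mc) SPINE v0 (`B-provers/B-p02/g16/F3Mc/SPINE-F3Mc.v0.B-p02g16.md`,
B-p02 (g16); pen B-plan1 (g19) 20:03:53Z ∕ 20:04:33Z): node **N2a′**, the port «token for token» of the ℂ-engine՚s ★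
`Motives.AbelianVariety.seesawSheaf_iff_graphCond` (M13 node N2a, B-p12 (g12)) from `(A₀ ∕ ℂ, Â₀ = A₀ ∕ K(Θ), T′ : SchemeOver ℂ)` to
`(A′ ∕ S′, hat ∕ S′, T : Over S′)` — an arbitrary abelian scheme `A′` over an arbitrary base `S′`, an arbitrary second abelian scheme
`hat` over `S′` carrying a rank-one module `P` on `A′ ×_{S′} hat` normalised along `ε_{A′} × 1_{hat}` (★ `AbelianSchemeOver.unitSlice`), and
a rigidified line bundle `ℒ` on `A′ ×_{S′} T` (★ `AbelianSchemeOver.RigidifiedLineBundle`).  The plumbing `GraphCond′` ∕ `seesawSheaf′` of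
the SPINE is SPELLED OUT (pen ruling D1: no new `def`): in `Over S′` with Mathlib՚s cartesian monoidal structure
(`(X ⊗ Y).left = pullback X.hom Y.hom`, `(X ◁ f).left`, `fst`, `snd`), the seesaw sheaf on `A′ ⊗ (T ⊗ hat)` is
`𝓕 := (A′ ◁ fst)^*ℒ ⊗ ((A′ ◁ snd)^*P)^∨` and, for `u : S ⟶ T ⊗ hat`, `GraphCond′ u :≡ (1_{A′} × (u ≫ snd))^*P ≅ (A′ ◁ (u ≫ fst))^*ℒ`
(`1_{A′} × g` = ★ `baseChangeToProd`).  Count-neutral capital: HC_CM is proved only modulo the 7 printed citations until rung 0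
closes — nothing here bears on a summit statement.

**`AbelianSchemeOver.seesawSheaf_iff_graphCond`** ([MumfordAV1970] §13, proof of the Thm. p. 125, first reduction; [MilneAV2008] I §8,
Thm. 8.9): «`(A′ ◁ u)^*𝓕 ≅ pr_S^*𝓜` for some rank-one `𝓜` on `S`» ⟺ `GraphCond′ u`.  Proof in `Ȟ¹(−, 𝒪^×)` verbatim as over `ℂ` (★
`nonempty_iso_iff_detClass_eq`, ★ `detClass_pullback_tensorObj_dual`): `[(A′ ◁ u)^*𝓕] = [(A′ ◁ (u ≫ fst))^*ℒ]·[(1 × (u ≫ snd))^*P]⁻¹`;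
`⇐` with `𝓜 = 𝒪_S`; `⇒`: the unit section `ε_S` of `A′ ×_{S′} S → S` pulls `[(A′ ◁ (u ≫ fst))^*ℒ]` and `[(1 × (u ≫ snd))^*P]` back to `1`
(`ℒ.rigid`, the normalisation of `P`, ★ `unitSection_baseChange_eq_unitSlice` and the naturality `ε_S ≫ (A′ ◁ ψ) = ψ ≫ ε_T` of §1) and
`pr_S^*[𝓜]` back to `[𝓜]` (`ε_S ≫ pr_S = 𝟙`, ★ `CechPic.pullback_id`), so `[𝓜] = 1`.  Rank one is the currency throughout.

* §1 `unitSection_baseChange_comp_whiskerLeft_left` — naturality of the unit section of `A′ ⊗ S → S` in `S : Over S′`;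
  `baseChangeToProd_eq_whiskerLeft_left'` — `1_{A′} × g = A′ ◁ g` on underlying maps (★ `DualPair.baseChangeToProd_eq_whiskerLeft_left`
  for an arbitrary second factor).
* §2 **`seesawSheaf_iff_graphCond`** — node N2a′.

## References
* [MumfordAV1970] D. Mumford, *Abelian Varieties* (1970), §13 (proof of the Thm. p. 125).
* [MilneAV2008] J. S. Milne, *Abelian Varieties* (2008), I §8 Thm. 8.9 (pp. 37–38).
* [MumfordFogartyKirwan1994] D. Mumford, J. Fogarty, F. Kirwan, *Geometric Invariant Theory*, 3rd ed. (1994), Ch. 6 §1 Def. 6.1 (p. 115),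
  §2 (p. 121).
* [Hartshorne1977] R. Hartshorne, *Algebraic Geometry* (1977), II Ex. 6.8, Prop. 6.12; III Ex. 4.5 (`Pic = Ȟ¹(𝒪^×)`).
-/

noncomputable section

-- Mathlib's `Over` monoidal API and `Scheme.Modules` section API are stated across semireducible wrappers.
set_option backward.isDefEq.respectTransparency false

universe u

open CategoryTheory CategoryTheory.Limits AlgebraicGeometry MonoidalCategory CartesianMonoidalCategory
open scoped MonObj

namespace Literature.AlgebraicGeometry.AbelianSchemes

namespace AbelianSchemeOver

open Literature.AlgebraicGeometry.Motives Literature.AlgebraicGeometry.AbelianVarieties Literature.AlgebraicGeometry.Modules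

variable {S' : Scheme.{u}} (A' hat : AbelianSchemeOver S')

/-! ## §1 Plumbing in `Over S′`: the unit section of `A′ ⊗ S → S` and `1_{A′} × g = A′ ◁ g` -/

/-- **The unit section of `A′ ×_{S′} S → S` is natural in `S`**: `ε_S ≫ (A′ ◁ ψ) = ψ ≫ ε_T` for every `ψ : S ⟶ T` in `Over S′`
(both are `(π_S ≫ ε_{A′}, ψ)`; `(A′ ⊗ S).left = A′ ×_{S′} S` by Mathlib `Over.tensorObj_left`, `ε_S` = ★ `(A′.baseChange S.hom).unitSection`).
[cite: MumfordFogartyKirwan1994, Ch. 6 §1 Definition 6.1 (p. 115)] -/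
theorem unitSection_baseChange_comp_whiskerLeft_left {S T : Over S'} (ψ : S ⟶ T) :
    (A'.baseChange S.hom).unitSection ≫ (A'.X ◁ ψ).left = ψ.left ≫ (A'.baseChange T.hom).unitSection := by
  apply pullback.hom_ext
  · rw [Category.assoc, Over.whiskerLeft_left_fst, unitSection_baseChange_comp_fst, Category.assoc, unitSection_baseChange_comp_fst,
      ← Category.assoc, Over.w ψ]
  · rw [Category.assoc, Over.whiskerLeft_left_snd, ← Category.assoc]
    erw [(A'.baseChange S.hom).unitSection_comp_hom, Category.id_comp, Category.assoc, (A'.baseChange T.hom).unitSection_comp_hom]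
    exact (Category.comp_id _).symm

/-- **`1_{A′} × g = A′ ◁ g` on underlying maps**, for an `S′`-morphism `g : S ⟶ hat` given in `Over S′` (★
`DualPair.baseChangeToProd_eq_whiskerLeft_left` for an arbitrary second factor `hat`). [cite: MilneAV2008, I §8 pp. 36–37] -/
theorem baseChangeToProd_eq_whiskerLeft_left' {S : Over S'} (g : S ⟶ hat.X) :
    A'.baseChangeToProd hat S.hom g.left (Over.w g) = (A'.X ◁ g).left := by
  apply pullback.hom_ext
  · exact (A'.baseChangeToProd_fst hat S.hom _ _).trans (Over.whiskerLeft_left_fst (R := A'.X) g).symm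
  · exact (A'.baseChangeToProd_snd hat S.hom _ _).trans (Over.whiskerLeft_left_snd (R := A'.X) g).symm

/-! ## §2 Node N2a′: rigidifications kill the twist -/

variable (P : (A'.prodLeft hat).Modules) {T : Over S'} (ℒ : A'.RigidifiedLineBundle T.hom)

/-- **RIGIDIFICATIONS KILL THE TWIST over a base** ((Mc) node N2a′; relative port of ★ `Motives.AbelianVariety.seesawSheaf_iff_graphCond`).
For `P` rank one on `A′ ×_{S′} hat` normalised along `ε_{A′} × 1_{hat}`, a rigidified `ℒ` on `A′ ×_{S′} T`, the seesaw sheaf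
`𝓕 = (A′ ◁ fst)^*ℒ ⊗ ((A′ ◁ snd)^*P)^∨` on `A′ ⊗ (T ⊗ hat)` and any `u : S ⟶ T ⊗ hat` in `Over S′`: «`(A′ ◁ u)^*𝓕 ≅ pr_S^*𝓜` for SOME
rank-one `𝓜` on `S`» iff «`(1_{A′} × (u ≫ snd))^*P ≅ (A′ ◁ (u ≫ fst))^*ℒ`» (`GraphCond′ u`, spelled out).  Classes in `Ȟ¹(A′ ⊗ S, 𝒪^×)`:
`[(A′ ◁ u)^*𝓕] = [(A′ ◁ (u ≫ fst))^*ℒ]·[(1 × (u ≫ snd))^*P]⁻¹`; the unit section `ε_S` pulls both factors back to `1` and `pr_S^*[𝓜]` back to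
`[𝓜]`, so `[𝓜] = 1`. [cite: MumfordAV1970, §13 (proof of the Thm. p. 125)] [cite: MilneAV2008, I §8 Thm. 8.9 (pp. 37–38)] -/
theorem seesawSheaf_iff_graphCond (hP1 : HasRank P 1)
    (hnorm : Nonempty ((Scheme.Modules.pullback (A'.unitSlice hat)).obj P ≅ unitModule hat.X.left))
    (S : Over S') (u : S ⟶ T ⊗ hat.X) :
    (∃ (𝓜 : S.left.Modules) (_ : HasRank 𝓜 1),
        Nonempty ((Scheme.Modules.pullback (A'.X ◁ u).left).obj
            (tensorObj ((Scheme.Modules.pullback (A'.X ◁ CartesianMonoidalCategory.fst T hat.X).left).obj ℒ.L)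
              (Modules.dual ((Scheme.Modules.pullback (A'.X ◁ CartesianMonoidalCategory.snd T hat.X).left).obj P))) ≅
          (Scheme.Modules.pullback (CartesianMonoidalCategory.snd A'.X S).left).obj 𝓜)) ↔
      Nonempty ((Scheme.Modules.pullback
          (A'.baseChangeToProd hat S.hom (u ≫ CartesianMonoidalCategory.snd T hat.X).left
            (Over.w (u ≫ CartesianMonoidalCategory.snd T hat.X)))).obj P ≅
        (Scheme.Modules.pullback (A'.X ◁ (u ≫ CartesianMonoidalCategory.fst T hat.X)).left).obj ℒ.L) := by
  -- `ℒ.L` read as a module on `(A′ ⊗ T).left` (the same scheme, cartesian-monoidal spelling)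
  have hℒ1 : HasRank (X := (A'.X ⊗ T).left) ℒ.L 1 := ℒ.hasRank_one
  have hℒff : IsFiniteLocallyFree (X := (A'.X ⊗ T).left) ℒ.L := HasRank.isFiniteLocallyFree' hℒ1
  have hPff : IsFiniteLocallyFree (X := (A'.X ⊗ hat.X).left) P := HasRank.isFiniteLocallyFree' hP1
  have hM1 : HasRank ((Scheme.Modules.pullback (A'.X ◁ CartesianMonoidalCategory.fst T hat.X).left).obj ℒ.L) 1 :=
    hasRank_pullback _ hℒ1
  have hN1 : HasRank ((Scheme.Modules.pullback (A'.X ◁ CartesianMonoidalCategory.snd T hat.X).left).obj P) 1 :=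
    hasRank_pullback _ hP1
  have h𝓕f : IsFiniteLocallyFree ((Scheme.Modules.pullback (A'.X ◁ u).left).obj
      (tensorObj ((Scheme.Modules.pullback (A'.X ◁ CartesianMonoidalCategory.fst T hat.X).left).obj ℒ.L)
        (Modules.dual ((Scheme.Modules.pullback (A'.X ◁ CartesianMonoidalCategory.snd T hat.X).left).obj P)))) :=
    isFiniteLocallyFree_pullback_tensorObj_dual _ hM1 hN1
  have h𝓕1 : HasRank ((Scheme.Modules.pullback (A'.X ◁ u).left).obj
      (tensorObj ((Scheme.Modules.pullback (A'.X ◁ CartesianMonoidalCategory.fst T hat.X).left).obj ℒ.L)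
        (Modules.dual ((Scheme.Modules.pullback (A'.X ◁ CartesianMonoidalCategory.snd T hat.X).left).obj P)))) 1 :=
    hasRank_pullback_tensorObj_dual _ hM1 hN1
  -- the two restriction maps of `GraphCond′` ARE `(A′ ◁ u) ≫ (A′ ◁ snd)`, `(A′ ◁ u) ≫ (A′ ◁ fst)`
  have hk₁ : A'.baseChangeToProd hat S.hom (u ≫ CartesianMonoidalCategory.snd T hat.X).left
      (Over.w (u ≫ CartesianMonoidalCategory.snd T hat.X)) =
        (A'.X ◁ u).left ≫ (A'.X ◁ CartesianMonoidalCategory.snd T hat.X).left := by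
    rw [baseChangeToProd_eq_whiskerLeft_left' A' hat (u ≫ CartesianMonoidalCategory.snd _ _), MonoidalCategory.whiskerLeft_comp,
      Over.comp_left]
  have hk₂ : (A'.X ◁ (u ≫ CartesianMonoidalCategory.fst T hat.X)).left =
      (A'.X ◁ u).left ≫ (A'.X ◁ CartesianMonoidalCategory.fst T hat.X).left := by
    rw [MonoidalCategory.whiskerLeft_comp, Over.comp_left]
  -- (I) the class of `(A′ ◁ u)^*𝓕` in `Ȟ¹(A′ ⊗ S, 𝒪^×)`
  have hI : detClass h𝓕f =
      CechPic.pullback ((A'.X ◁ u).left ≫ (A'.X ◁ CartesianMonoidalCategory.fst T hat.X).left) (detClass hℒff) *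
        (CechPic.pullback ((A'.X ◁ u).left ≫ (A'.X ◁ CartesianMonoidalCategory.snd T hat.X).left) (detClass hPff))⁻¹ := by
    have hA := detClass_pullback_tensorObj_dual (A'.X ◁ u).left hM1 hN1 h𝓕f
      ((hℒff.pullback (A'.X ◁ CartesianMonoidalCategory.fst T hat.X).left).pullback (A'.X ◁ u).left)
      ((hPff.pullback (A'.X ◁ CartesianMonoidalCategory.snd T hat.X).left).pullback (A'.X ◁ u).left)
    have hB : detClass ((hℒff.pullback (A'.X ◁ CartesianMonoidalCategory.fst T hat.X).left).pullback (A'.X ◁ u).left) =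
        CechPic.pullback ((A'.X ◁ u).left ≫ (A'.X ◁ CartesianMonoidalCategory.fst T hat.X).left) (detClass hℒff) :=
      (detClass_pullback _ _).trans (((congrArg (CechPic.pullback (A'.X ◁ u).left) (detClass_pullback _ hℒff))).trans
        (CechPic.pullback_comp _ _ _).symm)
    have hC : detClass ((hPff.pullback (A'.X ◁ CartesianMonoidalCategory.snd T hat.X).left).pullback (A'.X ◁ u).left) =
        CechPic.pullback ((A'.X ◁ u).left ≫ (A'.X ◁ CartesianMonoidalCategory.snd T hat.X).left) (detClass hPff) :=
      (detClass_pullback _ _).trans (((congrArg (CechPic.pullback (A'.X ◁ u).left) (detClass_pullback _ hPff))).trans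
        (CechPic.pullback_comp _ _ _).symm)
    exact hA.trans (congrArg₂ (fun a b => a * b⁻¹) hB hC)
  -- (II) the graph condition on classes
  have hII : Nonempty ((Scheme.Modules.pullback
          (A'.baseChangeToProd hat S.hom (u ≫ CartesianMonoidalCategory.snd T hat.X).left
            (Over.w (u ≫ CartesianMonoidalCategory.snd T hat.X)))).obj P ≅
        (Scheme.Modules.pullback (A'.X ◁ (u ≫ CartesianMonoidalCategory.fst T hat.X)).left).obj ℒ.L) ↔
      CechPic.pullback ((A'.X ◁ u).left ≫ (A'.X ◁ CartesianMonoidalCategory.snd T hat.X).left) (detClass hPff) =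
        CechPic.pullback ((A'.X ◁ u).left ≫ (A'.X ◁ CartesianMonoidalCategory.fst T hat.X).left) (detClass hℒff) := by
    have h0 := nonempty_iso_iff_detClass_eq
      (hasRank_pullback (A'.baseChangeToProd hat S.hom (u ≫ CartesianMonoidalCategory.snd T hat.X).left
        (Over.w (u ≫ CartesianMonoidalCategory.snd T hat.X))) hP1)
      (hasRank_pullback (A'.X ◁ (u ≫ CartesianMonoidalCategory.fst T hat.X)).left hℒ1)
      (hPff.pullback _) (hℒff.pullback _)
    have h1 := detClass_pullback (A'.baseChangeToProd hat S.hom (u ≫ CartesianMonoidalCategory.snd T hat.X).left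
        (Over.w (u ≫ CartesianMonoidalCategory.snd T hat.X))) hPff
    have h2 := detClass_pullback (A'.X ◁ (u ≫ CartesianMonoidalCategory.fst T hat.X)).left hℒff
    have e1 := congrArg (fun k => CechPic.pullback k (detClass hPff)) hk₁
    have e2 := congrArg (fun k => CechPic.pullback k (detClass hℒff)) hk₂
    refine h0.trans ⟨fun h => ?_, fun h => ?_⟩
    · exact (e1.symm.trans (h1.symm.trans (h.trans h2))).trans e2
    · exact h1.trans ((e1.trans (h.trans e2.symm)).trans h2.symm)
  -- (III) the unit section `ε_S` of `A′ ⊗ S → S` kills `pr_S`, `ℒ` and `P`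
  have e_snd : (A'.baseChange S.hom).unitSection ≫ (CartesianMonoidalCategory.snd A'.X S).left = 𝟙 _ :=
    (A'.baseChange S.hom).unitSection_comp_hom
  have hℒrig : CechPic.pullback (A'.baseChange T.hom).unitSection (detClass hℒff) = 1 := by
    obtain ⟨er⟩ := ℒ.rigid
    exact (detClass_pullback _ hℒff).symm.trans
      ((detClass_eq_of_iso er (hℒff.pullback _) isFiniteLocallyFree_unitModule).trans (detClass_unitModule_eq_one _))
  have hPrig : CechPic.pullback (A'.unitSlice hat) (detClass hPff) = 1 := by
    obtain ⟨en⟩ := hnorm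
    exact (detClass_pullback _ hPff).symm.trans
      ((detClass_eq_of_iso en (hPff.pullback _) isFiniteLocallyFree_unitModule).trans (detClass_unitModule_eq_one _))
  -- (the `Ȟ¹` functoriality instances are taken in term mode: the intermediate scheme `A′ ×_{S′} S` is spelled both as
  -- `(A′.baseChange S.hom).left` and as `(A′ ⊗ S).left`, definitionally but not syntactically equal)
  have hIIIℒ : CechPic.pullback (A'.baseChange S.hom).unitSection
      (CechPic.pullback ((A'.X ◁ u).left ≫ (A'.X ◁ CartesianMonoidalCategory.fst T hat.X).left) (detClass hℒff)) = 1 := by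
    refine (CechPic.pullback_comp (A'.baseChange S.hom).unitSection
      ((A'.X ◁ u).left ≫ (A'.X ◁ CartesianMonoidalCategory.fst T hat.X).left) (detClass hℒff)).symm.trans ?_
    rw [← Over.comp_left, ← MonoidalCategory.whiskerLeft_comp,
      unitSection_baseChange_comp_whiskerLeft_left A' (u ≫ CartesianMonoidalCategory.fst _ _), CechPic.pullback_comp]
    exact (congrArg (CechPic.pullback (u ≫ CartesianMonoidalCategory.fst T hat.X).left) hℒrig).trans (map_one _)
  have hIIIP : CechPic.pullback (A'.baseChange S.hom).unitSection
      (CechPic.pullback ((A'.X ◁ u).left ≫ (A'.X ◁ CartesianMonoidalCategory.snd T hat.X).left) (detClass hPff)) = 1 := by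
    refine (CechPic.pullback_comp (A'.baseChange S.hom).unitSection
      ((A'.X ◁ u).left ≫ (A'.X ◁ CartesianMonoidalCategory.snd T hat.X).left) (detClass hPff)).symm.trans ?_
    rw [← Over.comp_left, ← MonoidalCategory.whiskerLeft_comp,
      unitSection_baseChange_comp_whiskerLeft_left A' (u ≫ CartesianMonoidalCategory.snd _ _), unitSection_baseChange_eq_unitSlice,
      CechPic.pullback_comp]
    exact (congrArg (CechPic.pullback (u ≫ CartesianMonoidalCategory.snd T hat.X).left) hPrig).trans (map_one _)
  constructor
  · rintro ⟨𝓜, h𝓜1, ⟨φ⟩⟩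
    have h𝓜ff := HasRank.isFiniteLocallyFree' h𝓜1
    -- `[(A′ ◁ u)^*𝓕] = pr_S^*[𝓜]`
    have hc : detClass h𝓕f = CechPic.pullback (CartesianMonoidalCategory.snd A'.X S).left (detClass h𝓜ff) := by
      rw [detClass_eq_of_iso φ h𝓕f (h𝓜ff.pullback _), detClass_pullback]
    -- restrict to the unit section: `[𝓜] = 1`
    have h𝓜c : detClass h𝓜ff = 1 := by
      have h := congrArg (CechPic.pullback (A'.baseChange S.hom).unitSection) hc
      have h' : detClass h𝓜ff = CechPic.pullback (A'.baseChange S.hom).unitSection (detClass h𝓕f) := by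
        refine (Eq.trans ?_ (CechPic.pullback_comp (A'.baseChange S.hom).unitSection
          (CartesianMonoidalCategory.snd A'.X S).left (detClass h𝓜ff))).trans h.symm
        rw [e_snd, CechPic.pullback_id]
      rw [hI, map_mul, map_inv, hIIIℒ, hIIIP, inv_one, mul_one] at h'
      exact h'
    have h1 : detClass h𝓕f = 1 := by rw [hc, h𝓜c, map_one]
    rw [hI, mul_inv_eq_one] at h1
    exact hII.mpr h1.symm
  · intro hg
    refine ⟨unitModule S.left, hasRank_unitModule, ?_⟩
    have heq := hII.mp hg
    have h1 : detClass h𝓕f = 1 := by rw [hI, ← heq, mul_inv_cancel]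
    refine (nonempty_iso_iff_detClass_eq h𝓕1 (hasRank_pullback _ hasRank_unitModule) h𝓕f
      (isFiniteLocallyFree_unitModule.pullback _)).mpr ?_
    rw [h1]
    exact ((detClass_pullback (CartesianMonoidalCategory.snd A'.X S).left
      (isFiniteLocallyFree_unitModule (X := S.left))).trans
        (by rw [detClass_unitModule_eq_one, map_one])).symm

end AbelianSchemeOver

end Literature.AlgebraicGeometry.AbelianSchemes

end
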